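import Literature.NumberTheory.DiophantineGeometry.SmoothProperModelChartFrameUnits
import Literature.NumberTheory.DiophantineGeometry.SmoothProperModelBirationalGroupLawCoreUnit
import Literature.RingTheory.Localization.CocycleIdentityUnit
import HarnessLib

/-!
# The relative Jacobian of the birational group law on a smooth model is a unit

Topic `Literature/NumberTheory/DiophantineGeometry` (proofs only; no definitions, no named facts).
Step S7 «`Δ` is a unit» of the étale heart of the (W0) argument (Bosch–Lütkebohmert–Raynaud, *Néron
Models*, §4.3, proof of Prop. 6; Edixhoven–Romagny, Thm. 6.3): on the chart
`Spec (Γ(V) ⊗_R Γ(V))_h ⊆ D` of the domain of the extended group law `m : D → 𝒳`, the Jacobian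
determinant of `m♯` relative to the first factor, in the exact coordinates `d yᵢ` of the affine chart
`V`, is a unit (`isUnit_det_relJacobian`).  It is the composition of

* ★ `exists_basis_pow_mul_units_of_frame` («S7a», `SmoothProperModelChartFrameUnits`): the chart
  coefficient `f` of the generic-fibre frame `θ` is `ϖᴹ · u / ϖᴺ` on a chart meeting the special fibre;
* ★ `coreUnit_cocycle_identity`, `coreUnit_j_injective`, `coreUnit_j_includeRight`,
  `coreUnit_j_ms`, `coreUnit_phi2_algebraMap_eq`, `coreUnit_j_includeRight_ne_zero` («S7b»,
  `SmoothProperModelBirationalGroupLawCoreUnit`): the chart-to-function-field map `j` and the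
  identity `σ(pr₂♯ f) · j Δ = pr₂♯ f`;
* ★ `isUnit_of_cocycle_identity` (`RingTheory/Localization/CocycleIdentityUnit`): the pure-ring
  cancellation.

The conclusion is VERBATIM the hypothesis `hΔ` of the chart theorem
★ `flat_and_locallyOfFinitePresentation_lift_of_isUnit_det`. Cell `hodgecm-mathlib`, road W of `r₀`
((W0) S7).

## Sources

* S. Bosch, W. Lütkebohmert, M. Raynaud, *Néron Models*, Springer 1990, §4.3 Prop. 6 (proof),
  §4.2 Prop. 1–2, §2.3 Prop. 4. [BLRNeronModels1990]
* B. Edixhoven, M. Romagny, *Group schemes out of birational group laws, Néron models*, 2012,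
  Thm. 6.3. [EdixhovenRomagny2012]
-/

noncomputable section

universe u

namespace Literature.NumberTheory.DiophantineGeometry

open CategoryTheory Limits _root_.AlgebraicGeometry Opposite TopologicalSpace
open Literature.AlgebraicGeometry.Motives Literature.AlgebraicGeometry.Motives.RatFn
open Literature.AlgebraicGeometry.Smoothening Literature.NumberTheory.EllipticCurves
open Literature.RingTheory.Localization

variable (R : Type u) [CommRing R] [IsDomain R] [IsDiscreteValuationRing R]
  (K : Type u) [Field K] [Algebra R K] [IsFractionRing R K]
  (𝒳 : Over (Spec (.of R))) [IsIntegral 𝒳.left] (n : ℕ)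

section RelJacobian

open MonoidalCategory CartesianMonoidalCategory TensorProduct

/-- The localisation `A_h` of the coordinate ring `A` of an affine open chart `c : Spec A → Y` of an
integral scheme `Y` is a domain as soon as it is non-trivial (`A` is a domain, `h ≠ 0`). [folklore] -/
private theorem isDomain_away_of_chart {Y : Scheme.{u}} [IsIntegral Y] {A : Type u} [CommRing A]
    (c : Spec (.of A) ⟶ Y) [IsOpenImmersion c] (h : A) [Nontrivial (Localization.Away h)] :
    IsDomain (Localization.Away h) := by
  haveI : Nontrivial A := (algebraMap A (Localization.Away h)).domain_nontrivial
  haveI : Nonempty ↥(Spec (.of A)) := inferInstanceAs (Nonempty (PrimeSpectrum A))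
  haveI : IsIntegral (Spec (.of A)) := isIntegral_of_isOpenImmersion c
  haveI : IsDomain A := (affine_isIntegral_iff (.of A)).1 inferInstance
  have hh0 : h ≠ 0 := fun h0 => by
    have h1 := IsLocalization.Away.algebraMap_isUnit (S := Localization.Away h) h
    have h2 : algebraMap A (Localization.Away h) h = 0 := by
      have e := congrArg (algebraMap A (Localization.Away h)) h0
      rwa [map_zero] at e
    rw [h2, isUnit_zero_iff] at h1
    exact zero_ne_one h1
  exact IsLocalization.isDomain_localization (M := Submonoid.powers h)
    (powers_le_nonZeroDivisors_of_noZeroDivisors hh0)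

/-- The basic open `Spec A_h → Spec A → Y` of an affine open chart of an integral scheme is a dominant
open immersion as soon as `A_h` is non-trivial. [folklore] -/
private theorem isDominant_away_comp_chart {Y : Scheme.{u}} [IsIntegral Y] {A : Type u} [CommRing A]
    (c : Spec (.of A) ⟶ Y) [IsOpenImmersion c] (h : A) [Nontrivial (Localization.Away h)] :
    IsDominant (Spec.map (CommRingCat.ofHom (algebraMap A (Localization.Away h))) ≫ c) := by
  haveI : IsOpenImmersion (Spec.map (CommRingCat.ofHom (algebraMap A (Localization.Away h)))) :=
    IsOpenImmersion.of_isLocalization h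
  haveI : Nonempty ↥(Spec (.of (Localization.Away h))) :=
    inferInstanceAs (Nonempty (PrimeSpectrum (Localization.Away h)))
  exact ⟨((Spec.map (CommRingCat.ofHom (algebraMap A (Localization.Away h))) ≫ c)
    |>.isOpenEmbedding.isOpen_range.dense (Set.range_nonempty _))⟩

set_option maxHeartbeats 400000 in
/-- **The relative Jacobian of the birational group law is a unit on the chart** (Bosch–Lütkebohmert–
Raynaud, *Néron Models*, §4.3, proof of Prop. 6; Edixhoven–Romagny Thm. 6.3, step «`Δ` is a unit»).
Setting of the étale heart of (W0): `𝒳 → Spec R` a smooth model with geometrically irreducible fibres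
of the group scheme `E = 𝒳_K` over a dvr `R`, `θ = (f₀, y₀)` the rational top form over `R` which is a
frame over the generic fibre (★ L4a′, hypothesis `hθ`), `(D, m)` the datum extending the group law with
`Φ_D = (pr₁, m)` dominant and its function-field shear `σ` (`hσ`, `R`-linear: `hσR`), `hcocy` the
cocycle identity «`Φ^* pr₂^* θ = pr₂^* θ`» in the relative basis `B₂` (★ C5′, L4c′), `V ∋ x` an affine
chart meeting the special fibre with exact coordinates `d yᵢ`, `c` the product chart, and
`m♯ : Γ(V) → C = (Γ(V) ⊗_R Γ(V))_h` the group law on the basic open `Spec C → D`. Then for every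
basis `α = (d (1 ⊗ yᵢ))ᵢ` of `Ω[C⁄Γ(V)]` the relative Jacobian `α.det (d m♯yᵢ)ᵢ` is a unit of `C`.
Assembly of ★ `exists_basis_pow_mul_units_of_frame` («S7a»: the chart coefficient of `θ` is
`ϖᴹ·u/ϖᴺ`), ★ `coreUnit_cocycle_identity` and its companions («S7b»: `σ(pr₂♯ f) · j Δ = pr₂♯ f` in
`K(𝒳 × 𝒳)`), and the pure-ring lemma ★ `isUnit_of_cocycle_identity`; the statement is the hypothesis
`hΔ` of ★ `flat_and_locallyOfFinitePresentation_lift_of_isUnit_det` verbatim.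
[cite: BLRNeronModels1990, §4.3 Prop. 6 (proof)] [cite: EdixhovenRomagny2012, Thm. 6.3] -/
theorem isUnit_det_relJacobian
    [Smooth 𝒳.hom] [GeometricallyIrreducible 𝒳.hom] [SmoothOfRelativeDimension n 𝒳.hom]
    [IsIntegral (𝒳 ⊗ 𝒳).left] [IsDominant (fst 𝒳 𝒳).left] [IsDominant (snd 𝒳 𝒳).left]
    [Algebra R 𝒳.left.functionField]
    (hRL : algebraMap R 𝒳.left.functionField = stalkHom 𝒳 (genericPoint 𝒳.left))
    [Algebra 𝒳.left.functionField (𝒳 ⊗ 𝒳).left.functionField]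
    (hLM : algebraMap 𝒳.left.functionField (𝒳 ⊗ 𝒳).left.functionField =
      functionFieldMap (fst 𝒳 𝒳).left)
    -- the top form (★ L4a′ output)
    (f₀ : 𝒳.left.functionField) (y₀ : Fin n → 𝒳.left.functionField)
    (B₀ : Module.Basis (Fin n) 𝒳.left.functionField Ω[𝒳.left.functionField⁄R])
    (hB₀ : ∀ i, B₀ i = KaehlerDifferential.D R _ (y₀ i))
    (hθ : ∀ (p : 𝒳.left) (_ : 𝒳.hom.base p ∈ Set.range (specGenericPoint R K).base)
        (z : Fin n → 𝒳.left.presheaf.stalk p)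
        (b : letI := (stalkHom 𝒳 p).toAlgebra
          Module.Basis (Fin n) (𝒳.left.presheaf.stalk p) Ω[𝒳.left.presheaf.stalk p⁄R])
        (_ : letI := (stalkHom 𝒳 p).toAlgebra; ∀ i, b i = KaehlerDifferential.D R _ (z i))
        (B : Module.Basis (Fin n) 𝒳.left.functionField Ω[𝒳.left.functionField⁄R])
        (_ : ∀ i, B i = KaehlerDifferential.D R _ (toFunctionField p (z i))),
        IsUnitAt p (f₀ * B.det B₀))
    -- the shear datum and its action on `K(𝒳 ⊗ 𝒳)` (ISO-PACK outputs as hypotheses)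
    (D : (𝒳 ⊗ 𝒳).left.Opens) [Nonempty D] [IsDominant D.ι]
    (m : (D : Scheme.{u}) ⟶ 𝒳.left)
    (ΦD : (D : Scheme.{u}) ⟶ (𝒳 ⊗ 𝒳).left) [IsDominant ΦD] (hΦ₂ : ΦD ≫ (snd 𝒳 𝒳).left = m)
    (σ : (𝒳 ⊗ 𝒳).left.functionField →+* (𝒳 ⊗ 𝒳).left.functionField)
    (hσ : (functionFieldMap D.ι).comp σ = functionFieldMap ΦD)
    (hσR : σ.comp (stalkHom (𝒳 ⊗ 𝒳) (genericPoint (𝒳 ⊗ 𝒳).left)) =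
      stalkHom (𝒳 ⊗ 𝒳) (genericPoint (𝒳 ⊗ 𝒳).left))
    -- the relative basis (★ C5′) and the cocycle identity (L4c′ output as hypothesis)
    (B₂ : Module.Basis (Fin n) (𝒳 ⊗ 𝒳).left.functionField
        Ω[(𝒳 ⊗ 𝒳).left.functionField⁄𝒳.left.functionField])
    (hB₂ : ∀ i, B₂ i = KaehlerDifferential.D 𝒳.left.functionField _
        (functionFieldMap (snd 𝒳 𝒳).left (y₀ i)))
    (hcocy : σ (functionFieldMap (snd 𝒳 𝒳).left f₀) *
      B₂.det (fun i => KaehlerDifferential.D 𝒳.left.functionField _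
        (σ (functionFieldMap (snd 𝒳 𝒳).left (y₀ i)))) =
      functionFieldMap (snd 𝒳 𝒳).left f₀)
    -- the chart `V` (affine, exact Kähler basis `d yᵢ`), meeting the special fibre at `x`
    {V : 𝒳.left.Opens} (hV : IsAffineOpen V) (x : 𝒳.left) (hxV : x ∈ V)
    (hx : 𝒳.hom.base x = IsLocalRing.closedPoint R)
    (y : Fin n → Γ(𝒳.left, V))
    (bV : letI : Algebra R Γ(𝒳.left, V) :=
        ((Scheme.ΓSpecIso (.of R)).inv ≫ 𝒳.hom.appLE ⊤ V le_top).hom.toAlgebra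
      Module.Basis (Fin n) Γ(𝒳.left, V) Ω[Γ(𝒳.left, V)⁄R])
    (hbV : letI : Algebra R Γ(𝒳.left, V) :=
        ((Scheme.ΓSpecIso (.of R)).inv ≫ 𝒳.hom.appLE ⊤ V le_top).hom.toAlgebra
      ∀ i, bV i = KaehlerDifferential.D R _ (y i))
    -- the product chart `c` and the basic open `Spec (Γ(V) ⊗ Γ(V))_h → D`
    (c : letI : Algebra R Γ(𝒳.left, V) :=
        ((Scheme.ΓSpecIso (.of R)).inv ≫ 𝒳.hom.appLE ⊤ V le_top).hom.toAlgebra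
      Spec (.of (Γ(𝒳.left, V) ⊗[R] Γ(𝒳.left, V))) ⟶ (𝒳 ⊗ 𝒳).left)
    [IsOpenImmersion c]
    (hc₁ : letI : Algebra R Γ(𝒳.left, V) :=
        ((Scheme.ΓSpecIso (.of R)).inv ≫ 𝒳.hom.appLE ⊤ V le_top).hom.toAlgebra
      c ≫ (fst 𝒳 𝒳).left =
        Spec.map (CommRingCat.ofHom Algebra.TensorProduct.includeLeftRingHom) ≫ hV.fromSpec)
    (hc₂ : letI : Algebra R Γ(𝒳.left, V) :=
        ((Scheme.ΓSpecIso (.of R)).inv ≫ 𝒳.hom.appLE ⊤ V le_top).hom.toAlgebra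
      c ≫ (snd 𝒳 𝒳).left =
        Spec.map (CommRingCat.ofHom (Algebra.TensorProduct.includeRight (R := R)
          (A := Γ(𝒳.left, V)) (B := Γ(𝒳.left, V))).toRingHom) ≫ hV.fromSpec)
    (h : letI : Algebra R Γ(𝒳.left, V) :=
        ((Scheme.ΓSpecIso (.of R)).inv ≫ 𝒳.hom.appLE ⊤ V le_top).hom.toAlgebra
      Γ(𝒳.left, V) ⊗[R] Γ(𝒳.left, V))
    (ℓ : letI : Algebra R Γ(𝒳.left, V) :=
        ((Scheme.ΓSpecIso (.of R)).inv ≫ 𝒳.hom.appLE ⊤ V le_top).hom.toAlgebra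
      Spec (.of (Localization.Away h)) ⟶ D)
    (hℓ : letI : Algebra R Γ(𝒳.left, V) :=
        ((Scheme.ΓSpecIso (.of R)).inv ≫ 𝒳.hom.appLE ⊤ V le_top).hom.toAlgebra
      ℓ ≫ D.ι = Spec.map (CommRingCat.ofHom (algebraMap _ (Localization.Away h))) ≫ c)
    (ms : letI : Algebra R Γ(𝒳.left, V) :=
        ((Scheme.ΓSpecIso (.of R)).inv ≫ 𝒳.hom.appLE ⊤ V le_top).hom.toAlgebra
      Γ(𝒳.left, V) →+* Localization.Away h)
    (hms : letI : Algebra R Γ(𝒳.left, V) :=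
        ((Scheme.ΓSpecIso (.of R)).inv ≫ 𝒳.hom.appLE ⊤ V le_top).hom.toAlgebra
      Spec.map (CommRingCat.ofHom ms) ≫ hV.fromSpec = ℓ ≫ m) :
    letI : Algebra R Γ(𝒳.left, V) :=
        ((Scheme.ΓSpecIso (.of R)).inv ≫ 𝒳.hom.appLE ⊤ V le_top).hom.toAlgebra
    ∀ (α : Module.Basis (Fin n) (Localization.Away h) Ω[Localization.Away h⁄Γ(𝒳.left, V)]),
      (∀ i, α i = KaehlerDifferential.D Γ(𝒳.left, V) _
        (algebraMap _ (Localization.Away h) ((1 : Γ(𝒳.left, V)) ⊗ₜ[R] y i))) →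
      IsUnit (α.det fun i => KaehlerDifferential.D Γ(𝒳.left, V) _ (ms (y i))) := by
  intro α hα
  classical
  letI alg : Algebra R Γ(𝒳.left, V) :=
    ((Scheme.ΓSpecIso (.of R)).inv ≫ 𝒳.hom.appLE ⊤ V le_top).hom.toAlgebra
  haveI hVne : Nonempty V := ⟨⟨x, hxV⟩⟩
  -- ### S7a: the chart coefficient `f = f₀ · B_V.det B₀` of `θ` is `ϖᴹ · u / ϖᴺ` on `V`
  obtain ⟨ϖ, hϖ⟩ := IsDiscreteValuationRing.exists_irreducible R
  obtain ⟨BV, hBV, u, N, M, hf⟩ :=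
    exists_basis_pow_mul_units_of_frame K 𝒳 n hϖ hV hxV hx hRL bV hbV f₀ B₀ hθ
  have hπ : Prime (((Scheme.ΓSpecIso (.of R)).inv ≫ 𝒳.hom.appLE ⊤ V le_top).hom ϖ) :=
    prime_algebraMap_sections_of_mem_specialFibre 𝒳 hϖ hV hxV hx
  haveI := functionField_isFractionRing_of_isAffineOpen 𝒳.left V hV
  have hiB : Function.Injective (algebraMap Γ(𝒳.left, V) 𝒳.left.functionField) :=
    IsFractionRing.injective Γ(𝒳.left, V) 𝒳.left.functionField
  have hπK : algebraMap Γ(𝒳.left, V) 𝒳.left.functionField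
      (((Scheme.ΓSpecIso (.of R)).inv ≫ 𝒳.hom.appLE ⊤ V le_top).hom ϖ) ≠ 0 :=
    (map_ne_zero_iff _ hiB).2 hπ.ne_zero
  have hf₀ : f₀ ≠ 0 := by
    intro h0
    rw [h0, zero_mul, zero_mul] at hf
    exact mul_ne_zero (pow_ne_zero M hπK) ((map_ne_zero_iff _ hiB).2 u.ne_zero) hf.symm
  -- ### the trivial chart ring has nothing to prove; else:
  nontriviality (Localization.Away h)
  -- ### the chart ring `C = (Γ(V) ⊗ Γ(V))_h` is a domain; `cC : Spec C → 𝒳 × 𝒳` is a dominant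
  -- open immersion, and so are `ℓ` and `m`
  haveI hCdom : IsDomain (Localization.Away h) := isDomain_away_of_chart c h
  haveI : IsOpenImmersion (Spec.map (CommRingCat.ofHom
      (algebraMap (Γ(𝒳.left, V) ⊗[R] Γ(𝒳.left, V)) (Localization.Away h)))) :=
    IsOpenImmersion.of_isLocalization h
  haveI hcCdom : IsDominant (Spec.map (CommRingCat.ofHom
      (algebraMap (Γ(𝒳.left, V) ⊗[R] Γ(𝒳.left, V)) (Localization.Away h))) ≫ c) :=
    isDominant_away_comp_chart c h
  haveI : IsDominant (ℓ ≫ D.ι) := hℓ ▸ hcCdom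
  haveI : IsDominant ℓ := IsDominant.of_comp_of_isOpenImmersion ℓ D.ι
  haveI : IsDominant m := hΦ₂ ▸ inferInstance
  -- ### the single relative basis of the statement gives the cocycle identity for every such basis
  have hcocy' : ∀ B₂' : Module.Basis (Fin n) (𝒳 ⊗ 𝒳).left.functionField
      Ω[(𝒳 ⊗ 𝒳).left.functionField⁄𝒳.left.functionField],
      (∀ i, B₂' i = KaehlerDifferential.D 𝒳.left.functionField _
        (functionFieldMap (snd 𝒳 𝒳).left (y₀ i))) →
      σ (functionFieldMap (snd 𝒳 𝒳).left f₀) *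
        B₂'.det (fun i => KaehlerDifferential.D 𝒳.left.functionField _
          (σ (functionFieldMap (snd 𝒳 𝒳).left (y₀ i)))) =
      functionFieldMap (snd 𝒳 𝒳).left f₀ := by
    intro B₂' hB₂'
    obtain rfl : B₂' = B₂ := Module.Basis.eq_of_apply_eq fun i => by rw [hB₂', hB₂]
    exact hcocy
  -- ### S7b (★ B-p09): `j : C → K(𝒳 × 𝒳)`, the compatibilities and the identity; then the
  -- pure-ring lemma ★ `isUnit_of_cocycle_identity`
  have hjinj := coreUnit_j_injective (𝒳 := 𝒳) (C := .of (Localization.Away h))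
    (cC := Spec.map (CommRingCat.ofHom (algebraMap (Γ(𝒳.left, V) ⊗[R] Γ(𝒳.left, V))
      (Localization.Away h))) ≫ c) (hj := rfl)
  have hφ₂' := fun b : Γ(𝒳.left, V) => (coreUnit_j_includeRight (𝒳 := 𝒳) (c := c)
    (C := .of (Localization.Away h)) (hcC := rfl) (hj := rfl) (hc₂ := hc₂) (b := b)).symm
  have hμ' := fun b : Γ(𝒳.left, V) => (coreUnit_j_ms (𝒳 := 𝒳) (C := .of (Localization.Away h))
    (hj := rfl) (D := D) (hΦ₂ := hΦ₂) (σ := σ) (hσ := hσ) (ℓ := ℓ) (hℓ := hℓ) (ms := ms)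
    (hms := hms) (b := b)).symm
  have hπφ' := coreUnit_phi2_algebraMap_eq (𝒳 := 𝒳) (V₂ := V) (hRL := hRL) (h₂ := rfl) (σ := σ)
    (hσR := hσR) (r := ϖ)
  have hπ0' := coreUnit_j_includeRight_ne_zero (𝒳 := 𝒳) (c := c)
    (C := .of (Localization.Away h)) (hcC := rfl) (hj := rfl) (hc₂ := hc₂) (hb := hπK)
  have hΔ' := coreUnit_cocycle_identity (𝒳 := 𝒳) (hV₁ := hV) (hV₂ := hV) (c := c)
    (C := .of (Localization.Away h)) (hcC := rfl) (hj := rfl) (n := n) (hRL := hRL) (hLM := hLM)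
    (hc₁ := hc₁) (hc₂ := hc₂) (D := D) (m := m) (ΦD := ΦD) (hΦ₂ := hΦ₂) (σ := σ) (hσ := hσ)
    (hσR := hσR) (ℓ := ℓ) (hℓ := hℓ) (ms := ms) (hms := hms) (f₀ := f₀) (hf₀ := hf₀) (y₀ := y₀)
    (B₀ := B₀) (hB₀ := hB₀) (hcocy := hcocy') (y := y) (B_y := BV) (hB_y := hBV) (α := α)
    (hα := hα)
  exact isUnit_of_cocycle_identity _ hjinj
    ((algebraMap (Γ(𝒳.left, V) ⊗[R] Γ(𝒳.left, V)) (Localization.Away h)).comp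
      (Algebra.TensorProduct.includeRight (R := R) (A := Γ(𝒳.left, V))
        (B := Γ(𝒳.left, V))).toRingHom) ms (algebraMap Γ(𝒳.left, V) 𝒳.left.functionField)
    (functionFieldMap (snd 𝒳 𝒳).left) (σ.comp (functionFieldMap (snd 𝒳 𝒳).left)) hφ₂' hμ'
    (((Scheme.ΓSpecIso (.of R)).inv ≫ 𝒳.hom.appLE ⊤ V le_top).hom ϖ) hπφ' hπ0' hf _ hΔ'

end RelJacobian

end Literature.NumberTheory.DiophantineGeometry
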